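import Literature.AnabelianGeometry.EtaleTheta.BiKummerRoots
import Literature.AnabelianGeometry.EtaleTheta.Discharge.Sec4FractionPairs

/-!
# [EtTh] Prop 4.2 (i), (ii) — the named facts `Prop42_i`, `Prop42_ii` discharged modulo [FrdI] facts

Mochizuki, *The étale theta function …*, Publ. RIMS **45** (2009), §4, Prop. 4.2 (i)(ii), PDF p.88
[cite: MochizukiEtTh2009, Prop 4.2 p.88].  abc-iut cell, layer L2, ROW `EtTh:Prop4.2` (seat
abc-iut-L6-t12; statements typed by abc-iut-L2-t3 in `BiKummerRoots.lean`).  The named `Prop`s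
`BiKummerSetting.Prop42_i` ("a pair `t', t'' : A → C` is a right fraction-pair for `f` iff there is a
[necessarily unique] isomorphism `v : B ⥲ C` with `t' = v ∘ s'`, `t'' = v ∘ s''`") and
`BiKummerSetting.Prop42_ii` (left fraction-pairs, necessity + uniqueness) follow from the theorems of
`Discharge/Sec4FractionPairs.lean`; the hypotheses are the [FrdI] inputs of the printed proof (p.89):
`Φ` divisorial and `B` group-like ([FrdI] Thm. 5.2 (ii)), the dictionary `O^×(A^birat) = B(A_D)^×`
([FrdI] Thm. 5.2 (ii); identity for abc-iut-L2-t9's `mkOfModel`), and the cancellation / transport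
laws of disjoint supports ([FrdI] Prop. 4.1 (iii)).  Nothing else is assumed; typed ≠ proved for
Prop. 4.2 (iii), (iv).
-/

noncomputable section

namespace Literature.AnabelianGeometry.EtaleTheta

open CategoryTheory Opposite Literature.AlgebraicGeometry.Frobenioids

universe u₀ v₀ u v w

variable {K : Type u₀} [Field K]

namespace BiKummerSetting

variable {X : SemiGraphs.TemperedArithmeticGroup.{u₀} K} {D₀ : Type u₀} [Category.{v₀} D₀]
  {V : FrdIMonoidStub.{w}} {T : RealifiedDivisorMonoids (D₀ := D₀) V} {D : Type u} [Category.{v} D]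
  {VD : FrdICatStub.{u, v, w} D} (S : BiKummerSetting X T D VD)

/-- **[EtTh] Proposition 4.2 (i) — the named fact `Prop42_i` DISCHARGED modulo [FrdI] facts**: for
`Φ` divisorial, `B` group-like, a dictionary `toB : O^×(A^birat) ↪ B(A_D)^×` computing the fractions
([FrdI] Thm. 5.2 (ii)) and the cancellation law of disjoint supports ([FrdI] Prop. 4.1 (iii)),
"`(t', t'')` is a right fraction-pair for `f` ⟺ `∃!` isomorphism `v` with `t' = v ∘ s'`, `t'' = v ∘ s''`".
[cite: MochizukiEtTh2009, Prop 4.2(i) p.88] -/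
theorem prop42_i_of
    (hΦd : Objectwise (fun M _ => IsDivisorial M) S.tf.divisorMonoid)
    (hBg : Objectwise (fun M _ => IsGroupLike M) S.tf.ratFnFunctor)
    (toB : ∀ A : S.C, S.biratUnits A →* (S.tf.ratFnFunctor.obj (op A.base))ˣ)
    (htoB : ∀ A : S.C, Function.Injective (toB A))
    (hfrac : ∀ {A B : S.C} (s' s'' : A ⟶ B) (h' : S.IsPreStep s') (h'' : S.IsPreStep s'')
      (hb : PreFrobenioid.BaseEquivalent S.F s' s''),
      (toB A (S.fracOf s' s'' h' h'' hb) : S.tf.ratFnFunctor.obj (op A.base)) *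
        ModelFrobenioid.unit s'' = ModelFrobenioid.unit s')
    (hDS : ∀ {A : Dᵒᵖ} {a b a' b' : S.tf.Φ.carrier A}, S.DisjointSupports a b →
      S.DisjointSupports a' b' → a * b' = a' * b → a = a' ∧ b = b') :
    S.Prop42_i := by
  intro A B C f P t' t''
  constructor
  · rintro ⟨Q, hQn, hQd⟩
    obtain ⟨v, ⟨h1, h2⟩, huniq⟩ := FractionPair.existsUnique_iso hΦd hBg toB hfrac hDS P Q
    exact ⟨v, ⟨h1.trans hQn, h2.trans hQd⟩,
      fun v' hv' => huniq v' ⟨hv'.1.trans hQn.symm, hv'.2.trans hQd.symm⟩⟩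
  · rintro ⟨v, ⟨h1, h2⟩, -⟩
    obtain ⟨Q, hQn, hQd⟩ := FractionPair.exists_comp_iso hΦd hBg toB htoB hfrac P v
    exact ⟨Q, hQn.trans h1, hQd.trans h2⟩

/-- **[EtTh] Proposition 4.2 (ii) — the named fact `Prop42_ii` DISCHARGED modulo [FrdI] facts**: under
the same hypotheses plus compatibility of the dictionary with restriction along pre-steps
(`Base(s)^* toB(f|_B) = toB(f)`) and transport of disjoint supports along base-isomorphisms, a left
fraction-pair `(t', t'') : C → B` for `f|_B` arises from `(s', s'')` by a unique isomorphism `v : C ⥲ A`.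
[cite: MochizukiEtTh2009, Prop 4.2(ii) p.88] -/
theorem prop42_ii_of
    (hΦd : Objectwise (fun M _ => IsDivisorial M) S.tf.divisorMonoid)
    (hBg : Objectwise (fun M _ => IsGroupLike M) S.tf.ratFnFunctor)
    (toB : ∀ A : S.C, S.biratUnits A →* (S.tf.ratFnFunctor.obj (op A.base))ˣ)
    (hfrac : ∀ {A B : S.C} (s' s'' : A ⟶ B) (h' : S.IsPreStep s') (h'' : S.IsPreStep s'')
      (hb : PreFrobenioid.BaseEquivalent S.F s' s''),
      (toB A (S.fracOf s' s'' h' h'' hb) : S.tf.ratFnFunctor.obj (op A.base)) *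
        ModelFrobenioid.unit s'' = ModelFrobenioid.unit s')
    (hres : ∀ {A B : S.C} (s : A ⟶ B) (hs : S.IsPreStep s) (x : S.biratUnits A),
      pull S.tf.ratFnFunctor (ModelFrobenioid.baseMap s)
        (toB B (S.restrictAlong s hs x) : S.tf.ratFnFunctor.obj (op B.base)) =
        (toB A x : S.tf.ratFnFunctor.obj (op A.base)))
    (hDS : ∀ {A : Dᵒᵖ} {a b a' b' : S.tf.Φ.carrier A}, S.DisjointSupports a b →
      S.DisjointSupports a' b' → a * b' = a' * b → a = a' ∧ b = b')
    (hDSι : ∀ {A A' : D} (e : A' ⟶ A) [IsIso e] {a b : S.tf.Φ.carrier (op A)},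
      S.DisjointSupports a b →
        S.DisjointSupports (pull S.tf.divisorMonoid e a) (pull S.tf.divisorMonoid e b)) :
    S.Prop42_ii :=
  fun _ P _ Q hPQ => FractionPair.existsUnique_iso_left hΦd hBg toB hfrac hres hDS hDSι P Q hPQ

end BiKummerSetting

end Literature.AnabelianGeometry.EtaleTheta

end
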